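import Summits.HubbardSuperconductivity.HubbardSuperconductivity.Theorems.WidthHaldaneColumnCorrelatorBounds
import Summits.HubbardSuperconductivity.HubbardSuperconductivity.Theorems.WidthHaldaneTubeKinematics
import Literature.MathematicalPhysics.QuantumLattice.FinDimSpectrumSectorGibbsLimit
import Literature.MathematicalPhysics.QuantumLattice.PairCorrelationsProofs

/-!
# Sketch — crux-ideate round 1, ideator 1, crux `WidthHaldaneBridge` (stmt-HubbardSuperconductivity-16311)

First lemmas of the two idea cards filed by this seat, stated over the LANDED tube vocabulary
(`Theorems/WidthHaldaneDefs.lean`: `tubeH0`, `tubeFilling`, `tubeStiffness`, `UniformThermo`,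
`HaldaneLaw`, `tubeDWavePair`, `tubeColumnPairCorr`, …):

* card `twist-transfer-floors` — `cutKinetic`, `LeggettFloor` (first lemma), `KineticFloor`,
  `CurrentRigidity` (second lemma);
* card `pair-repulsion-dual` — `columnPair`, `pairRepulsion`, `re_expect_pairRepulsion`,
  `DualHaldaneLaw`, `haldaneLaw_of_dual` (first lemma, PROVED), `DualBridge`,
  `widthHaldaneBridge_of_dualBridge` (PROVED), `columnStructureFactorZero`, `BochnerFloor`.
-/

noncomputable section

namespace Summit.HubbardSuperconductivity.HubbardSuperconductivity.Cruxes.WidthHaldaneBridge.IdeaSketch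

set_option linter.dupNamespace false

open scoped BigOperators Classical Matrix ComplexConjugate
open Matrix Literature.MathematicalPhysics.QuantumLattice
open Summit.HubbardSuperconductivity.HubbardSuperconductivity.Theorems.WidthHaldane
open Summit.HubbardSuperconductivity.HubbardSuperconductivity.Theses.WidthHaldane (WidthHaldaneBridge)

/-! ## Card `twist-transfer-floors`: UniformThermo bites on every θ = 0 ground state -/

/-- Kinetic energy carried across the cut between the columns `a - 1` and `a` (its `M`
longitudinal bonds, both spins) in the vector `ψ`:
`k_a(ψ) = Σ_{b,σ} Re⟨ψ, (c†_{(a,b)σ} c_{(a-1,b)σ} + c†_{(a-1,b)σ} c_{(a,b)σ}) ψ⟩`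
(sign convention: `tubeH0 ⊇ -Σ_a K_a`, so `k_a > 0` means energy-lowering bonds). -/
def cutKinetic (L M : ℕ) [NeZero L] [NeZero M] (Λ : Type) [LinearOrder Λ] [Fintype Λ] (e : Λ ≃ ZMod L × ZMod M)
    (ψ : Fock (Orb Λ)) (a : ZMod L) : ℝ :=
  ∑ b : ZMod M, ∑ σ : Fin 2,
    (expect (creation (orb (e.symm (a, b)) σ) * annihilation (orb (e.symm (a - 1, b)) σ) +
        creation (orb (e.symm (a - 1, b)) σ) * annihilation (orb (e.symm (a, b)) σ)) ψ).re

/-- **FIRST LEMMA of card `twist-transfer-floors` (Leggett's bound run backwards).**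
Under `UniformThermo`, every normalised sector ground state `ψ` of every admissible untwisted
tube carries STRICTLY POSITIVE kinetic energy across EVERY cut, and the cut kinetic energies have
harmonic mean `≥ d₀·M`:  `d₀ · M · Σ_a k_a(ψ)⁻¹ ≤ L`.
Mechanism: relocate/spread the `π/3` flux with an arbitrary column profile `(φ_a)`, `Σ_a φ_a = π/3`
(pure gauges, `WidthHaldaneTubeStepGauge`/`TubeTwoCut`), price `ψ` in the gauged Hamiltonian,
average `±φ` using `E(-θ) = E(θ)` (`tubeEnergy_neg`) to kill the bond currents, use
`1 - cos φ ≤ φ²/2` and optimise `φ_a ∝ 1/k_a` (series resistors, Paramekanti–Trivedi–Randeria 1998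
§IV eq. (var-bd), Leggett 1970): `E(π/3) - E(0) ≤ (π/3)²/(2 Σ_a k_a⁻¹)`; a nonpositive `k_a`
would give `E(π/3) ≤ E(0)`, contradicting `d₀ ≤ ρ̃`. -/
def LeggettFloor : Prop :=
  ∀ (U δ d₀ k₀ : ℝ) (M₁ L₀ : ℕ), 0 < d₀ → UniformThermo U δ d₀ k₀ M₁ L₀ →
    ∀ (L M : ℕ) [NeZero L] [NeZero M], Even L → Even M → M₁ ≤ M → M ≤ L → L₀ ≤ L → 3 ≤ L →
      ∀ (Λ : Type) [LinearOrder Λ] [Fintype Λ] (e : Λ ≃ ZMod L × ZMod M) (ψ : Fock (Orb Λ)),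
        star ψ ⬝ᵥ ψ = 1 → IsGroundStateInSector (tubeH0 L M Λ e U) (tubeFilling L M δ) 0 ψ →
          (∀ a : ZMod L, 0 < cutKinetic L M Λ e ψ a) ∧
            d₀ * (M : ℝ) * ∑ a : ZMod L, (cutKinetic L M Λ e ψ a)⁻¹ ≤ (L : ℝ)

/-- Uniform-profile corollary (`φ_a = π/(3L)`, or AM–HM from `LeggettFloor`): the stiffness floor is a
floor on the MEAN longitudinal kinetic energy per bond of every sector ground state,
`d₀ · L · M ≤ Σ_a k_a(ψ)` — the lattice form of `D_s/π ≤ ⟨K_1⟩` (Scalapino–White–Zhang 1993;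
PTR 1998 eq. (ke-bd)) read as a constraint on `ψ`. -/
def KineticFloor : Prop :=
  ∀ (U δ d₀ k₀ : ℝ) (M₁ L₀ : ℕ), 0 < d₀ → UniformThermo U δ d₀ k₀ M₁ L₀ →
    ∀ (L M : ℕ) [NeZero L] [NeZero M], Even L → Even M → M₁ ≤ M → M ≤ L → L₀ ≤ L → 3 ≤ L →
      ∀ (Λ : Type) [LinearOrder Λ] [Fintype Λ] (e : Λ ≃ ZMod L × ZMod M) (ψ : Fock (Orb Λ)),
        star ψ ⬝ᵥ ψ = 1 → IsGroundStateInSector (tubeH0 L M Λ e U) (tubeFilling L M δ) 0 ψ →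
          d₀ * (L : ℝ) * (M : ℝ) ≤ ∑ a : ZMod L, cutKinetic L M Λ e ψ a

/-- The total longitudinal kinetic operator `K = Σ_{a,b,σ} (c†_{(a,b)σ} c_{(a-1,b)σ} + h.c.)`. -/
def longKinetic (L M : ℕ) [NeZero L] [NeZero M] (Λ : Type) [LinearOrder Λ] [Fintype Λ] (e : Λ ≃ ZMod L × ZMod M) :
    Matrix (Finset (Orb Λ)) (Finset (Orb Λ)) ℂ :=
  ∑ a : ZMod L, ∑ b : ZMod M, ∑ σ : Fin 2,
    (creation (orb (e.symm (a, b)) σ) * annihilation (orb (e.symm (a - 1, b)) σ) +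
      creation (orb (e.symm (a - 1, b)) σ) * annihilation (orb (e.symm (a, b)) σ))

/-- The total longitudinal paramagnetic current `J = i Σ_{a,b,σ} (c†_{(a,b)σ} c_{(a-1,b)σ} - h.c.)`. -/
def longCurrent (L M : ℕ) [NeZero L] [NeZero M] (Λ : Type) [LinearOrder Λ] [Fintype Λ] (e : Λ ≃ ZMod L × ZMod M) :
    Matrix (Finset (Orb Λ)) (Finset (Orb Λ)) ℂ :=
  ∑ a : ZMod L, ∑ b : ZMod M, ∑ σ : Fin 2,
    Complex.I • (creation (orb (e.symm (a, b)) σ) * annihilation (orb (e.symm (a - 1, b)) σ) -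
      creation (orb (e.symm (a - 1, b)) σ) * annihilation (orb (e.symm (a, b)) σ))

/-- The uniformly spread `π/3` twist as a perturbation of `tubeH0`:
`T = (1 - cos(π/(3L))) K + sin(π/(3L)) J`, so that `W_g (tubeH0 + tubeTwist (π/3)) W_gᴴ = tubeH0 + T`
for the linear twist gauge `g` (`WidthHaldaneTubeGauge.expect_gauged_tubeH`). -/
def spreadTwist (L M : ℕ) [NeZero L] [NeZero M] (Λ : Type) [LinearOrder Λ] [Fintype Λ] (e : Λ ≃ ZMod L × ZMod M) :
    Matrix (Finset (Orb Λ)) (Finset (Orb Λ)) ℂ :=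
  ((1 - Real.cos (Real.pi / 3 / L) : ℝ) : ℂ) • longKinetic L M Λ e +
    ((Real.sin (Real.pi / 3 / L) : ℝ) : ℂ) • longCurrent L M Λ e

/-- **SECOND LEMMA of card `twist-transfer-floors` (Kohn's formula as an inequality; "current
rigidity", FULL variational form).** `UniformThermo` says `tubeH0 + T - E₀ - c ≥ 0` on the sector as
a quadratic form (`E₀` the untwisted sector minimum, `c = d₀(π/3)²M/(2L)`, `T = spreadTwist`, either
sign of its current part by `E(-θ) = E(θ)`). Written in the frame of a ground state `ψ` (test vectors
`ψ + ζ`, `ζ ⊥ ψ` in the sector, `(tubeH0 - E₀)ψ = 0`) this is the inequality below; its supremum over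
`ζ` is the second-order (paramagnetic) energy the system could recover by screening the twist,
`⟨Tψ, (Q(H₀ + T - E₀ - c)Q)⁻¹ Tψ⟩`, which is thereby bounded by the first-order cost `⟨ψ,Tψ⟩ - c ≈
(k̄ - d₀)(π/3)²M/(2L)`: the paramagnetic current weight of EVERY sector ground state falls short of the
diamagnetic one by `d₀` per site (Scalapino–White–Zhang's `D_s = ⟨-k_x⟩ - Λ_xx > 0`, PTR 1998 §III,
as a constraint ON `ψ`). A metal violates it through the sum over its `O(LM)` soft inter-channel
particle–hole pairs; a single soft `ζ` never does — the content is collective. -/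
def CurrentRigidity : Prop :=
  ∀ (U δ d₀ k₀ : ℝ) (M₁ L₀ : ℕ), 0 < d₀ → UniformThermo U δ d₀ k₀ M₁ L₀ →
    ∀ (L M : ℕ) [NeZero L] [NeZero M], Even L → Even M → M₁ ≤ M → M ≤ L → L₀ ≤ L → 3 ≤ L →
      ∀ (Λ : Type) [LinearOrder Λ] [Fintype Λ] (e : Λ ≃ ZMod L × ZMod M) (ψ ζ : Fock (Orb Λ)),
        star ψ ⬝ᵥ ψ = 1 → IsGroundStateInSector (tubeH0 L M Λ e U) (tubeFilling L M δ) 0 ψ →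
          ζ ∈ szSector (tubeFilling L M δ) (0 : ℝ) → star ζ ⬝ᵥ ψ = 0 →
            -(2 * (star ζ ⬝ᵥ (spreadTwist L M Λ e *ᵥ ψ)).re) -
                  (star ζ ⬝ᵥ ((tubeH0 L M Λ e U + spreadTwist L M Λ e) *ᵥ ζ)).re +
                ((tubeH0 L M Λ e U).minEnergyOn (szSector (tubeFilling L M δ) 0) +
                    d₀ * (Real.pi / 3) ^ 2 * M / (2 * L)) * (star ζ ⬝ᵥ ζ).re ≤
              (expect (spreadTwist L M Λ e) ψ).re - d₀ * (Real.pi / 3) ^ 2 * M / (2 * L)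

/-! ## Card `pair-repulsion-dual`: the pointwise floor as a ground-ENERGY inequality -/

section Dual

variable (L M : ℕ) [NeZero L] [NeZero M] (Λ : Type) [LinearOrder Λ] [Fintype Λ]
  (e : Λ ≃ ZMod L × ZMod M)

/-- The column `d_{x²-y²}` pair field `Φ_a = Σ_b P_{e⁻¹(a,b)}`. -/
def columnPair (a : ZMod L) : Matrix (Finset (Orb Λ)) (Finset (Orb Λ)) ℂ :=
  ∑ b : ZMod M, tubeDWavePair L M Λ e (e.symm (a, b))

/-- The symmetrised column pair–pair coupling at long-cycle displacement `r`:
`X_r = Σ_a (Φ_a† Φ_{a+r} + Φ_{a+r}† Φ_a)` — a number-conserving, Hermitian two-body "pair hopping by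
`r`" source; `Re⟨ψ, X_r ψ⟩ = 2·G_ψ(r)` (`re_expect_pairRepulsion`). -/
def pairRepulsion (r : ZMod L) : Matrix (Finset (Orb Λ)) (Finset (Orb Λ)) ℂ :=
  ∑ a : ZMod L, ((columnPair L M Λ e a)ᴴ * columnPair L M Λ e (a + r) +
    (columnPair L M Λ e (a + r))ᴴ * columnPair L M Λ e a)

theorem isHermitian_pairRepulsion (r : ZMod L) : (pairRepulsion L M Λ e r).IsHermitian := by
  unfold pairRepulsion
  rw [IsHermitian, conjTranspose_sum]
  refine Finset.sum_congr rfl fun a _ => ?_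
  rw [conjTranspose_add, conjTranspose_mul, conjTranspose_mul, conjTranspose_conjTranspose,
    conjTranspose_conjTranspose, add_comm]

/-- `Re⟨ψ, X_r ψ⟩ = 2·G_ψ(r)`. -/
theorem re_expect_pairRepulsion (ψ : Fock (Orb Λ)) (r : ZMod L) :
    (expect (pairRepulsion L M Λ e r) ψ).re = 2 * tubeColumnPairCorr L M Λ e ψ r := by
  rw [tubeColumnPairCorr_eq_sum_dotProduct, pairRepulsion, expect_sum, Complex.re_sum,
    Finset.mul_sum]
  refine Finset.sum_congr rfl fun a _ => ?_
  rw [expect_add, Complex.add_re, PosSemidefTrace.expect_conjTranspose_mul,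
    PosSemidefTrace.expect_conjTranspose_mul]
  have key : star (columnPair L M Λ e (a + r) *ᵥ ψ) ⬝ᵥ (columnPair L M Λ e a *ᵥ ψ) =
      star (star (columnPair L M Λ e a *ᵥ ψ) ⬝ᵥ (columnPair L M Λ e (a + r) *ᵥ ψ)) :=
    star_dotProduct _ _
  rw [key, Complex.star_def, Complex.conj_re]
  simp only [columnPair]
  ring

/-- THE DUAL (ENERGY) FORM OF THE HALDANE LAW with constants `(Ξ, A, R, M₂, L₁)`: for every
admissible tube and displacement there is an `h > 0` (allowed to depend on everything) such that
adding the REPULSIVE pair–pair source `h·X_r` to the pure tube raises the `(N, S^z = 0)` sector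
minimum by at least `h · 2A·L·M²·r̂^{-Ξ√(ẽ″/ρ̃)/M}`. -/
def DualHaldaneLaw (U δ Ξ A : ℝ) (R M₂ L₁ : ℕ) : Prop :=
  ∀ (L M : ℕ) [NeZero L] [NeZero M], Even L → Even M → M₂ ≤ M → M ≤ L → L₁ ≤ L →
    ∀ (Λ : Type) [LinearOrder Λ] [Fintype Λ] (e : Λ ≃ ZMod L × ZMod M) (r : ZMod L),
      R ≤ r.val → r.val + R ≤ L →
        ∃ h : ℝ, 0 < h ∧
          (tubeH0 L M Λ e U).minEnergyOn (szSector (tubeFilling L M δ) 0) +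
              h * (2 * (A * (L : ℝ) * (M : ℝ) ^ 2 * ((min r.val (L - r.val) : ℕ) : ℝ) ^
                (-(Ξ * Real.sqrt (tubePairCompressibility L M Λ e U δ / tubeStiffness L M Λ e U δ) /
                  (M : ℝ))))) ≤
            (tubeH0 L M Λ e U + h • pairRepulsion L M Λ e r).minEnergyOn
              (szSector (tubeFilling L M δ) 0)

end Dual

/-- **FIRST LEMMA of card `pair-repulsion-dual` (PROVED): the dual energy law implies the Haldane
law with the SAME constants.** Variational principle only: a normalised sector ground state `ψ` of
`tubeH0` priced in `tubeH0 + h·X_r` gives `E₀ + h·2·floor ≤ λ_min(tubeH0 + hX_r) ≤ E₀ + h·2G_ψ(r)`. -/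
theorem haldaneLaw_of_dual {U δ Ξ A : ℝ} {R M₂ L₁ : ℕ} (h : DualHaldaneLaw U δ Ξ A R M₂ L₁) :
    HaldaneLaw U δ Ξ A R M₂ L₁ := by
  intro L M _ _ hLe hMe hM hML hL Λ _ _ e ψ hψ hGS r hr hrL
  obtain ⟨h0, hh0, hE⟩ := h L M hLe hMe hM hML hL Λ e r hr hrL
  obtain ⟨hmem, -, hHψ⟩ := hGS
  -- the perturbed tube is Hermitian
  have hHerm : (tubeH0 L M Λ e U + h0 • pairRepulsion L M Λ e r).IsHermitian :=
    (isHermitian_tubeH0 L M Λ e U).add ((isHermitian_pairRepulsion L M Λ e r).smul (IsSelfAdjoint.all h0))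
  -- variational principle with the ground state `ψ`
  have hvar := minEnergyOn_le_rayleigh_of_mem hHerm (szSector (tubeFilling L M δ) 0) hmem hψ
  -- ⟨ψ, (H₀ + hX) ψ⟩ = E₀ + h ⟨ψ, X ψ⟩ = E₀ + h · 2 G_ψ(r)
  have hsplit : (star ψ ⬝ᵥ (tubeH0 L M Λ e U + h0 • pairRepulsion L M Λ e r) *ᵥ ψ).re =
      (tubeH0 L M Λ e U).minEnergyOn (szSector (tubeFilling L M δ) 0) +
        h0 * (2 * tubeColumnPairCorr L M Λ e ψ r) := by
    rw [add_mulVec, dotProduct_add, Complex.add_re, hHψ, dotProduct_smul, hψ, smul_mulVec,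
      dotProduct_smul, ← re_expect_pairRepulsion L M Λ e ψ r]
    simp [expect]
  rw [hsplit] at hvar
  have key : h0 * (2 * (A * (L : ℝ) * (M : ℝ) ^ 2 * ((min r.val (L - r.val) : ℕ) : ℝ) ^
      (-(Ξ * Real.sqrt (tubePairCompressibility L M Λ e U δ / tubeStiffness L M Λ e U δ) / (M : ℝ))))) ≤
      h0 * (2 * tubeColumnPairCorr L M Λ e ψ r) := by linarith
  have key2 := le_of_mul_le_mul_left key hh0
  linarith

/-- The dual bridge: `UniformThermo` forces the dual (energy) law. Open — this is where the card's
engines (operator/SOS inequalities relative to the twisted family, Anderson cluster bounds, NPA/RDM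
certificates with the `UniformThermo` inequalities as localizing constraints) are aimed. -/
def DualBridge : Prop :=
  ∀ U : ℝ, 0 < U → ∀ δ ∈ Set.Ioo (0 : ℝ) (3 / 10), ∀ (d₀ k₀ : ℝ) (M₁ L₀ : ℕ), 0 < d₀ →
    UniformThermo U δ d₀ k₀ M₁ L₀ →
      ∃ Ξ : ℝ, 0 < Ξ ∧ ∃ A : ℝ, 0 < A ∧ ∃ R M₂ L₁ : ℕ, DualHaldaneLaw U δ Ξ A R M₂ L₁

/-- `DualBridge → WidthHaldaneBridge` (PROVED; the transfer stub of the line). -/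
theorem widthHaldaneBridge_of_dualBridge (h : DualBridge) : WidthHaldaneBridge := by
  rw [widthHaldaneBridge_iff]
  intro U hU δ hδ d₀ k₀ M₁ L₀ hd₀ hth
  obtain ⟨Ξ, hΞ, A, hA, R, M₂, L₁, hdual⟩ := h U hU δ hδ d₀ k₀ M₁ L₀ hd₀ hth
  exact ⟨Ξ, hΞ, A, hA, R, M₂, L₁, haldaneLaw_of_dual hdual⟩

/-! ### Handling the `r`-quantifier inside certificates: Bochner positivity of `r ↦ G_ψ(r)` -/

/-- The `q = 0` column pair structure factor `Ĝ_ψ(0) = ‖(Σ_a Φ_a) ψ‖² = Re⟨ψ, Δ† Δ ψ⟩`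
(`Δ = Σ_a Φ_a` the total `d_{x²-y²}` pair field of the tube). -/
def columnStructureFactorZero (L M : ℕ) [NeZero L] [NeZero M] (Λ : Type) [LinearOrder Λ]
    [Fintype Λ] (e : Λ ≃ ZMod L × ZMod M) (ψ : Fock (Orb Λ)) : ℝ :=
  (expect ((∑ a : ZMod L, columnPair L M Λ e a)ᴴ * (∑ a : ZMod L, columnPair L M Λ e a)) ψ).re

/-- **Bochner floor** (support lemma for both cards; provable by finite Fourier analysis on `ℤ/L`):
`r ↦ G_ψ(r)` is positive-definite (`Ĝ_ψ(q) = ‖Φ̂_q ψ‖² ≥ 0`, `Σ_q Ĝ_ψ(q) = L·G_ψ(0)`), hence the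
POINTWISE floor `G_ψ(r) ≥ (2Ĝ_ψ(0) - L·G_ψ(0))/L` at EVERY displacement: in the coherent regime the
whole `r`-quantifier of the law is discharged by two scalars, the `q = 0` structure factor and the
equal-column weight. -/
def BochnerFloor : Prop :=
  ∀ (L M : ℕ) [NeZero L] [NeZero M] (Λ : Type) [LinearOrder Λ] [Fintype Λ]
    (e : Λ ≃ ZMod L × ZMod M) (ψ : Fock (Orb Λ)) (r : ZMod L),
      (2 * columnStructureFactorZero L M Λ e ψ - (L : ℝ) * tubeColumnPairCorr L M Λ e ψ 0) / (L : ℝ) ≤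
        tubeColumnPairCorr L M Λ e ψ r

end Summit.HubbardSuperconductivity.HubbardSuperconductivity.Cruxes.WidthHaldaneBridge.IdeaSketch

end
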